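import Summits.ValiantsHypothesis.ValiantsHypothesis.Theorems.BarrierLeverDefinableEquationsFullRankMethod

/-!
# Route BarrierLever — the MODEL axis of crux `DefinableEquations` (stmt-8745) / item
# `SingleSizeEquations` (stmt-8749): NATURAL PROOFS AGAINST SYNTACTICALLY MULTILINEAR CIRCUITS OF
# SIZE `< c n²/log² n` (Alon–Kumar–Volk 2020 made FSV-natural, regime `d = n`; val-np-p5 g9)

Composition of `FullRankMethod.not_isSuccinctHittingSet_not_isFullRank` (the full-rank method is
an algebraically natural proof: the product `E_n` of the `C(2n,n)` cut determinants, size/degree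
`≤ C(4n,2n)^5`, `q = 0`, vanishes exactly where some balanced cut is rank deficient) with the
TREE THEOREM `AlonKumarVolk2020_thm20_holds` (Alon–Kumar–Volk 2020, Thm. 20, kernel-checked in
`Literature/Barriers/ValiantsHypothesis/FullRankMultilinearThm20.lean`: every fan-in-two
syntactically multilinear circuit computing a full-rank `g ∈ K[x_1,…,x_{2n}]` has
`≥ c n²/log² n` gates):

* `naturalProofsAgainstSyntacticallyMultilinearCircuits` — there is `c > 0` such that for all
  `n ≥ 11` the polynomials computed by fan-in-two syntactically multilinear circuits with
  `< c n²/log² n` gates are NOT a succinct hitting set for `Distinguishers ℂ (2n) 5`;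
* `…_smallCircuits` — the sub-slice of `SmallCircuits ℂ (2n) 2`;
* `syntacticallyMultilinearSliceEquations` — the crux's `q = 0` Boolean-sum shape on the slice.

Place on the chart: for GENERAL circuits the tree has natural proofs against every LINEAR size
(`NaturalProofsAgainstAllLinearSizes`, Baur–Strassen) and size `n²` is the crux (b = 2, OPEN);
this is a SUPERLINEAR size, `Θ(n²/log² n)`, for an unbounded-depth circuit model.  What this is
NOT: the lower-bound content is Alon–Kumar–Volk's (already in the tree); nothing on general
size-`n²` circuits or on `VP ≠ VNP`.  No definitions, no named facts; standard axioms.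
Refs: Alon–Kumar–Volk 2020 Thm. 20; Forbes–Shpilka–Volk 2018 Def. 1/3, Thm. 4.
-/

-- `Summit.ValiantsHypothesis.ValiantsHypothesis.…` repeats a component by the D-0017 layout
-- (single-conjunct summit), which the `dupNamespace` linter flags; the name is mandated.
set_option linter.dupNamespace false

noncomputable section

namespace Summit.ValiantsHypothesis.ValiantsHypothesis.Theorems.BarrierLeverDefinableEquations

open MvPolynomial
open Literature.Computability.AlgebraicComplexity hiding smCircuitSize IsSyntacticallyMultilinear
open Literature.Barriers.ValiantsHypothesis
open scoped BigOperators

namespace FullRankMethod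

variable {n : ℕ}

/-! ## §4 Natural proofs against syntactically multilinear circuits of size `o(n²/log² n)` -/

/-- **NATURAL PROOFS AGAINST SYNTACTICALLY MULTILINEAR CIRCUITS OF SIZE `< c n²/log² n`**
(Alon–Kumar–Volk 2020 made FSV-natural, regime `d = n`).  There is `c > 0` such that for every
`n ≥ 11` the polynomials `g ∈ ℂ[x_1, …, x_{2n}]` computed by a fan-in-two syntactically
multilinear circuit with `< c n²/log² n` gates are NOT a succinct hitting set for
`Distinguishers ℂ (2n) 5`: the full-rank equation `E_n` (size/degree `≤ C(4n,2n)^5`, no Boolean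
variables) is nonzero and vanishes on all of them, because by the tree theorem
`AlonKumarVolk2020_thm20_holds` none of them is of full rank.  A SUPERLINEAR size on the model
axis; general circuits of size `n²` are the crux (OPEN). [cite: AlonKumarVolk2020, Thm. 20] [cite: ForbesShpilkaVolk2018, Thm. 4] -/
theorem naturalProofsAgainstSyntacticallyMultilinearCircuits :
    ∃ c : ℝ, 0 < c ∧ ∀ n : ℕ, 11 ≤ n →
      ¬ IsSuccinctHittingSet (degLEMonomials (2 * n))
        {g : MvPolynomial (Fin (2 * n)) ℂ | ∃ P : ArithCircuit ℂ (Fin (2 * n)), P.IsFanInTwo ∧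
          IsSyntacticallyMultilinear P ∧ P.Computes g ∧
          (P.size : ℝ) < c * (n : ℝ) ^ 2 / Real.log n ^ 2}
        (Distinguishers ℂ (2 * n) 5) := by
  obtain ⟨c, hc, H⟩ := AlonKumarVolk2020_thm20_holds.{0}
  refine ⟨c, hc, fun n hn h => not_isSuccinctHittingSet_not_isFullRank hn (h.mono ?_ le_rfl)⟩
  rintro g ⟨P, h2, hsm, hP, hsize⟩ hfull
  exact absurd (H ℂ n (by omega) g hfull P h2 hsm hP) (not_le.2 hsize)

/-- **Alon–Kumar–Volk's bound populates the technique class**: there is `c > 0` such that for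
all `n ≥ 2` and every `s` with `s < c n²/log² n`, full rank forces syntactically multilinear size
`> s` (`FullRankMethodProves ℂ n s`). [cite: AlonKumarVolk2020, Thm. 20] -/
theorem fullRankMethodProves_of_lt :
    ∃ c : ℝ, 0 < c ∧ ∀ n : ℕ, 2 ≤ n → ∀ s : ℕ,
      (s : ℝ) < c * (n : ℝ) ^ 2 / Real.log n ^ 2 → FullRankMethodProves ℂ n s := by
  obtain ⟨c, hc, H⟩ := AlonKumarVolk2020_thm20_holds.{0}
  refine ⟨c, hc, fun n hn s hs g hg => ?_⟩
  -- every admissible circuit has `> s`, i.e. `≥ s + 1`, gates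
  have hle : (((s + 1 : ℕ)) : ℕ∞) ≤ Literature.Barriers.ValiantsHypothesis.smCircuitSize g := by
    refine le_iInf₂ fun P hP => ?_
    have h1 : (s : ℝ) < P.size := hs.trans_le (H ℂ n hn g hg P hP.1 hP.2.1 hP.2.2)
    exact_mod_cast Nat.succ_le_of_lt (by exact_mod_cast h1)
  exact lt_of_lt_of_le (by exact_mod_cast Nat.lt_succ_self s) hle

/-- **`smCircuitSize` form**: there is `c > 0` such that for all `n ≥ 11` and every `s` with
`s < c n²/log² n`, `{g : smCircuitSize g ≤ s}` is NOT a succinct hitting set for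
`Distinguishers ℂ (2n) 5`. [cite: AlonKumarVolk2020, Thm. 20] [cite: ForbesShpilkaVolk2018, Thm. 4] -/
theorem not_isSuccinctHittingSet_smCircuitSize_le :
    ∃ c : ℝ, 0 < c ∧ ∀ n : ℕ, 11 ≤ n → ∀ s : ℕ, (s : ℝ) < c * (n : ℝ) ^ 2 / Real.log n ^ 2 →
      ¬ IsSuccinctHittingSet (degLEMonomials (2 * n))
        {g : MvPolynomial (Fin (2 * n)) ℂ |
          Literature.Barriers.ValiantsHypothesis.smCircuitSize g ≤ (s : ℕ∞)}
        (Distinguishers ℂ (2 * n) 5) := by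
  obtain ⟨c, hc, H⟩ := fullRankMethodProves_of_lt
  exact ⟨c, hc, fun n hn s hs =>
    not_isSuccinctHittingSet_of_fullRankMethodProves hn (H n (by omega) s hs)⟩

/-- **The sub-slice of `SmallCircuits ℂ (2n) 2`.**  The same for the members of
`SmallCircuits ℂ (2n) 2` (degree `≤ 2n`, fan-in-two size `≤ (2n)²`) that have a syntactically
multilinear circuit with `< c n²/log² n` gates (a subclass; `IsSuccinctHittingSet.mono`).
[cite: AlonKumarVolk2020, Thm. 20] -/
theorem naturalProofsAgainstSyntacticallyMultilinearCircuits_smallCircuits :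
    ∃ c : ℝ, 0 < c ∧ ∀ n : ℕ, 11 ≤ n →
      ¬ IsSuccinctHittingSet (degLEMonomials (2 * n))
        {g : MvPolynomial (Fin (2 * n)) ℂ | g ∈ SmallCircuits ℂ (2 * n) 2 ∧
          ∃ P : ArithCircuit ℂ (Fin (2 * n)), P.IsFanInTwo ∧ IsSyntacticallyMultilinear P ∧
            P.Computes g ∧ (P.size : ℝ) < c * (n : ℝ) ^ 2 / Real.log n ^ 2}
        (Distinguishers ℂ (2 * n) 5) := by
  obtain ⟨c, hc, H⟩ := naturalProofsAgainstSyntacticallyMultilinearCircuits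
  refine ⟨c, hc, fun n hn h => H n hn (h.mono ?_ le_rfl)⟩
  rintro g ⟨-, hP⟩
  exact hP

/-- **The crux's `∀ b ∃ a` shape on the syntactically multilinear slice** (`q = 0` Boolean
variables): there is `c > 0` such that for every `n ≥ 11` some datum `H` with
`L(H), deg H ≤ C(4n,2n)^5` and `boolSum H ≠ 0` vanishes at `coeff(g)` for every `g` computed by a
fan-in-two syntactically multilinear circuit with `< c n²/log² n` gates — the statement
`SingleSizeEquations` asks for (at `2n` variables, level `a = 5`), with `SmallCircuits ℂ (2n) b`
replaced by this slice. [cite: AlonKumarVolk2020, Thm. 20] [cite: ForbesShpilkaVolk2018, Def. 1] -/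
theorem syntacticallyMultilinearSliceEquations :
    ∃ c : ℝ, 0 < c ∧ ∀ n : ℕ, 11 ≤ n →
      ∃ q : ℕ, q ≤ Nat.choose (2 * (2 * n)) (2 * n) ^ 5 ∧
        ∃ H : MvPolynomial (↥(degLEMonomials (2 * n)) ⊕ Fin q) ℂ,
          complexity H ≤ Nat.choose (2 * (2 * n)) (2 * n) ^ 5 ∧
          H.totalDegree ≤ Nat.choose (2 * (2 * n)) (2 * n) ^ 5 ∧ boolSum H ≠ 0 ∧
          ∀ g : MvPolynomial (Fin (2 * n)) ℂ,
            (∃ P : ArithCircuit ℂ (Fin (2 * n)), P.IsFanInTwo ∧ IsSyntacticallyMultilinear P ∧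
              P.Computes g ∧ (P.size : ℝ) < c * (n : ℝ) ^ 2 / Real.log n ^ 2) →
            eval (coeffVector (degLEMonomials (2 * n)) g) (boolSum H) = 0 := by
  obtain ⟨c, hc, Hc⟩ := naturalProofsAgainstSyntacticallyMultilinearCircuits
  refine ⟨c, hc, fun n hn => ?_⟩
  obtain ⟨D, hD, hD0, hvan⟩ := (exists_isNaturalProof_iff _ _ _).mpr (Hc n hn)
  -- `q = 0`: the empty Boolean sum of `rename inl D` is `D`
  have hbs : boolSum (m := 0) (MvPolynomial.rename Sum.inl D) = D := by
    rw [boolSum, Fintype.sum_unique, MvPolynomial.aeval_rename, Sum.elim_comp_inl,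
      MvPolynomial.aeval_X_left, AlgHom.coe_id, id_eq]
  refine ⟨0, Nat.zero_le _, MvPolynomial.rename Sum.inl D, ?_, ?_, ?_, fun g hg => ?_⟩
  · exact (complexity_rename_le_holds' _ _).trans hD.1
  · exact (MvPolynomial.totalDegree_rename_le _ _).trans hD.2
  · rwa [hbs]
  · rw [hbs]; exact hvan g hg

end FullRankMethod

end Summit.ValiantsHypothesis.ValiantsHypothesis.Theorems.BarrierLeverDefinableEquations
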